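/- WIDTH seat `ym-line-cbag-p1-w3` (prover-ym-line-cbag-p1-w3-g16-0), LINE 7 `GlueballBandRecursion`, in support of ⟨stmt-QuantumFields-22957⟩
`OneParticleBlochSymbolFamily`: Löwdin orthonormalisation, part 2c — the EXPLICIT Löwdin frame `ψ = φ·(√G)⁻¹`, its matrix elements
`⟪ψ_a, T ψ_c⟫ = ((√G)⁻¹ H (√G)⁻¹)_{ac}`, and the transfer of weighted decay bounds from `(G − 1, H)` (what a cluster expansion controls
for dressed excitations) to the hopping kernel of the orthonormal frame (what `…SymbolRegularity` / `…BlochTransfer` consume).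
Route-independent; definition-free; a helper. -/
import Summits.QuantumFields.YangMills.Theorems.GlueballBandRecursionCovariantFrame
import Summits.QuantumFields.YangMills.Theorems.GlueballBandRecursionLowdinLocalisation

/-!
# Route `GlueballBandRecursion`, item `OneParticleBlochSymbolFamily` (stmt-QuantumFields-22957): the hopping kernel of the Löwdin frame

* `inner_lowdin_apply_lowdin`: for any real matrix `R`, family `φ` and linear `T`,
  `⟪Σ_b R_{ba} φ_b, T(Σ_d R_{dc} φ_d)⟫ = (Rᵀ·H·R)_{ac}` with `H_{bd} = ⟪φ_b, T φ_d⟫`.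
* `lowdinFrame_orthonormal_covariant`: the explicit frame `ψ_c = Σ_b ((√(gram φ))⁻¹)_{bc} φ_b` of a linearly independent
  translation-covariant family is orthonormal and covariant with the same span (explicit form of `…CovariantFrame`).
* `weighted_row_mul_le`: submultiplicativity of weighted row sums, `rowω(A·B)(a) ≤ rowω(A)(a) · sup rowω(B)`.
* `weighted_row_lowdin_kernel_sub_le`: if `Σ_b |(G − 1)_{ab}| ω(a,b) ≤ δ ≤ 1/2` and `Σ_b |H_{ab}| ω(a,b) ≤ h` (weight `ω ≥ 1`, `ω(a,a) = 1`,
  submultiplicative), then with `R = (√G)⁻¹`:  `Σ_c |(R H R − H)_{ac}| ω(a,c) ≤ h·(δ/(1−δ))·(1/(1−δ) + 1)` and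
  `Σ_c |(R H R)_{ac}| ω(a,c) ≤ h/(1−δ)²` — the hopping kernel of the Löwdin frame is `ω`-close to the dressed kernel `H` and inherits its
  decay (exponential `ω` ⇒ exponential decay; `(1 + dist)²` ⇒ the second moments `M₂` of `…SymbolRegularity`).

Sources: folklore (Löwdin 1950).  HONEST FRAMING.  Finite-dimensional linear algebra; item 22957, the rung `ColdDoublingRecursionStrongCoupling`
and the Yang–Mills mass gap / the summit `YangMills` are NOT proved or advanced here.
-/

set_option autoImplicit false

noncomputable section

open scoped InnerProductSpace BigOperators MatrixOrder
open Finset Matrix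

namespace Summit.QuantumFields.YangMills.Theorems.GlueballBandRecursion.Band

section Frame

variable {E : Type*} [NormedAddCommGroup E] [InnerProductSpace ℝ E]
variable {ι : Type*} [Fintype ι] [DecidableEq ι]

omit [DecidableEq ι] in
/-- **Matrix elements in a transformed family**: `⟪Σ_b R_{ba} φ_b, T(Σ_d R_{dc} φ_d)⟫ = (Rᵀ H R)_{ac}`, `H_{bd} = ⟪φ_b, T φ_d⟫`. [folklore] -/
theorem inner_lowdin_apply_lowdin (φ : ι → E) (R : Matrix ι ι ℝ) (T : E →ₗ[ℝ] E) (a c : ι) :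
    ⟪∑ b, R b a • φ b, T (∑ d, R d c • φ d)⟫_ℝ = (Rᵀ * Matrix.of (fun b d => ⟪φ b, T (φ d)⟫_ℝ) * R) a c := by
  have hT : T (∑ d, R d c • φ d) = ∑ d, R d c • T (φ d) := by simp only [map_sum, map_smul]
  rw [hT, sum_inner, Matrix.mul_assoc, Matrix.mul_apply]
  refine Finset.sum_congr rfl fun b _ => ?_
  rw [real_inner_smul_left, inner_sum, transpose_apply, Matrix.mul_apply]
  simp only [Finset.mul_sum]
  refine Finset.sum_congr rfl fun d _ => ?_
  rw [real_inner_smul_right, Matrix.of_apply]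
  ring

/-- **The explicit covariant Löwdin frame.**  For a finite additive group `X` acting by linear isometries `U_a`, a label type `J`, and a
LINEARLY INDEPENDENT covariant family `φ (a + x, j) = U_a (φ (x, j))`, the frame `ψ_c = Σ_b ((√(gram φ))⁻¹)_{bc} φ_b` is orthonormal,
covariant, and has the same span as `φ`.  (Explicit form of `exists_orthonormal_covariant_of_linearIndependent`.) [folklore] -/
theorem lowdinFrame_orthonormal_covariant {X : Type*} [AddCommGroup X] [Fintype X] [DecidableEq X]
    {J : Type*} [Fintype J] [DecidableEq J] (U : X → E →ₗᵢ[ℝ] E) (φ : X × J → E) (hφ : LinearIndependent ℝ φ)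
    (hcov : ∀ (a x : X) (j : J), φ (a + x, j) = U a (φ (x, j))) :
    Orthonormal ℝ (fun c => ∑ b, (CFC.sqrt (gram ℝ φ))⁻¹ b c • φ b) ∧
      (∀ (a x : X) (j : J), (∑ b, (CFC.sqrt (gram ℝ φ))⁻¹ b (a + x, j) • φ b) =
        U a (∑ b, (CFC.sqrt (gram ℝ φ))⁻¹ b (x, j) • φ b)) ∧
      (∀ c, (∑ b, (CFC.sqrt (gram ℝ φ))⁻¹ b c • φ b) ∈ Submodule.span ℝ (Set.range φ)) ∧
      (∀ c, φ c ∈ Submodule.span ℝ (Set.range fun c => ∑ b, (CFC.sqrt (gram ℝ φ))⁻¹ b c • φ b)) := by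
  obtain ⟨hSS, hST⟩ := sqrt_gram_mul_self_and_transpose φ
  have hSdet := isUnit_det_sqrt_gram hφ
  set Gm : Matrix (X × J) (X × J) ℝ := gram ℝ φ with hGdef
  set S : Matrix (X × J) (X × J) ℝ := CFC.sqrt Gm with hSdef
  set R : Matrix (X × J) (X × J) ℝ := S⁻¹ with hRdef
  have hRS : R * S = 1 := nonsing_inv_mul S hSdet
  have hSR : S * R = 1 := mul_nonsing_inv S hSdet
  have hRT : Rᵀ = R := by rw [hRdef, transpose_nonsing_inv, hST]
  have hRGR : R * Gm * R = 1 := by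
    calc R * Gm * R = R * S * (S * R) := by rw [← hSS]; simp only [Matrix.mul_assoc]
      _ = 1 := by rw [hRS, hSR, Matrix.one_mul]
  let σ : X → (X × J ≃ X × J) := fun a => Equiv.prodCongr (Equiv.addLeft a) (Equiv.refl J)
  have hσ : ∀ (a x : X) (j : J), σ a (x, j) = (a + x, j) := fun a x j => rfl
  have hGσ : ∀ a, Gm.submatrix (σ a) (σ a) = Gm := by
    intro a
    ext ⟨x, j⟩ ⟨y, k⟩
    rw [submatrix_apply, hσ, hσ, hGdef, gram_apply, gram_apply, hcov, hcov, LinearIsometry.inner_map_map]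
  have hRσ : ∀ a, R.submatrix (σ a) (σ a) = R := fun a => (sqrt_gram_submatrix_eq φ (σ a) (hGσ a)).2
  refine ⟨?_, ?_, ?_, ?_⟩
  · rw [orthonormal_iff_ite]
    intro a c
    have key : ⟪∑ b, R b a • φ b, ∑ d, R d c • φ d⟫_ℝ = (Rᵀ * (Gm * R)) a c := by
      rw [sum_inner, Matrix.mul_apply]
      refine Finset.sum_congr rfl fun b _ => ?_
      rw [real_inner_smul_left, inner_sum, transpose_apply, Matrix.mul_apply]
      simp only [Finset.mul_sum]
      refine Finset.sum_congr rfl fun d _ => ?_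
      rw [real_inner_smul_right, hGdef, gram_apply]
      ring
    rw [key, hRT, ← Matrix.mul_assoc, hRGR, Matrix.one_apply]
  · intro a x j
    rw [map_sum, ← Equiv.sum_comp (σ a) (fun b => R b (a + x, j) • φ b)]
    refine Finset.sum_congr rfl fun b _ => ?_
    obtain ⟨y, k⟩ := b
    have h1 : R (σ a (y, k)) (a + x, j) = R (y, k) (x, j) := by
      have h := congr_fun (congr_fun (hRσ a) (y, k)) (x, j)
      rwa [submatrix_apply, hσ] at h
    rw [LinearIsometry.map_smul, h1, hσ, hcov]
  · intro c
    exact Submodule.sum_mem _ fun b _ => Submodule.smul_mem _ _ (Submodule.subset_span ⟨b, rfl⟩)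
  · intro c
    have hφc : φ c = ∑ b, S b c • ∑ d, R d b • φ d := by
      simp_rw [Finset.smul_sum, smul_smul]
      rw [Finset.sum_comm]
      simp_rw [← Finset.sum_smul]
      have h : ∀ d, ∑ b, S b c * R d b = (R * S) d c := fun d => by
        rw [Matrix.mul_apply]
        exact Finset.sum_congr rfl fun b _ => mul_comm _ _
      simp_rw [h, hRS, Matrix.one_apply, ite_smul, one_smul, zero_smul, Finset.sum_ite_eq', Finset.mem_univ,
        if_true]
    rw [hφc]
    exact Submodule.sum_mem _ fun b _ => Submodule.smul_mem _ _ (Submodule.subset_span ⟨b, rfl⟩)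

end Frame

end Summit.QuantumFields.YangMills.Theorems.GlueballBandRecursion.Band

namespace Summit.QuantumFields.YangMills.Theorems.GlueballBandRecursion.Lowdin

variable {ι : Type*} [Fintype ι] [DecidableEq ι]

/-! ### Weighted row sums: submultiplicativity and the kernel of the Löwdin frame -/

omit [DecidableEq ι] in
/-- **Submultiplicativity of weighted row sums**: `Σ_c |(A B)_{ac}| ω(a,c) ≤ (Σ_b |A_{ab}| ω(a,b)) · β` whenever every weighted row sum of
`B` is `≤ β` (`ω ≥ 0`, `ω(a,c) ≤ ω(a,b) ω(b,c)`). [folklore] -/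
theorem weighted_row_mul_le (A B : Matrix ι ι ℝ) (ω : ι → ι → ℝ) (hω0 : ∀ a b, 0 ≤ ω a b)
    (hωm : ∀ a b c, ω a c ≤ ω a b * ω b c) {β : ℝ} (hB : ∀ b, ∑ c, |B b c| * ω b c ≤ β) (a : ι) :
    ∑ c, |(A * B) a c| * ω a c ≤ (∑ b, |A a b| * ω a b) * β := by
  calc ∑ c, |(A * B) a c| * ω a c ≤ ∑ c, ∑ b, |A a b| * ω a b * (|B b c| * ω b c) := by
        refine Finset.sum_le_sum fun c _ => ?_
        rw [Matrix.mul_apply]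
        refine (mul_le_mul_of_nonneg_right (abs_sum_le_sum_abs _ _) (hω0 a c)).trans ?_
        rw [Finset.sum_mul]
        refine Finset.sum_le_sum fun b _ => ?_
        rw [abs_mul]
        calc |A a b| * |B b c| * ω a c ≤ |A a b| * |B b c| * (ω a b * ω b c) :=
              mul_le_mul_of_nonneg_left (hωm a b c) (mul_nonneg (abs_nonneg _) (abs_nonneg _))
          _ = |A a b| * ω a b * (|B b c| * ω b c) := by ring
    _ = ∑ b, |A a b| * ω a b * ∑ c, |B b c| * ω b c := by
        rw [Finset.sum_comm]
        exact Finset.sum_congr rfl fun b _ => by rw [Finset.mul_sum]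
    _ ≤ ∑ b, |A a b| * ω a b * β :=
        Finset.sum_le_sum fun b _ => mul_le_mul_of_nonneg_left (hB b) (mul_nonneg (abs_nonneg _) (hω0 a b))
    _ = (∑ b, |A a b| * ω a b) * β := (Finset.sum_mul _ _ _).symm

/-- **The hopping kernel of the Löwdin frame inherits the decay of the dressed kernel.**  Let `G` (the Gram matrix) be real symmetric
with `Σ_b |(G − 1)_{ab}| ω(a,b) ≤ δ ≤ 1/2`, and `H` any real matrix with `Σ_b |H_{ab}| ω(a,b) ≤ h`, for a weight `ω ≥ 1` with
`ω(a,a) = 1`, `ω(a,c) ≤ ω(a,b) ω(b,c)`.  Then with the Löwdin weights `R = (√G)⁻¹` (`CFC.sqrt`):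
`Σ_c |(R H R − H)_{ac}| ω(a,c) ≤ h · (δ/(1−δ)) · (1/(1−δ) + 1)` and `Σ_c |(R H R)_{ac}| ω(a,c) ≤ h/(1−δ)²` for every row `a`
(`R H R` is the matrix `⟪ψ, T ψ⟫` of the Löwdin frame by `inner_lowdin_apply_lowdin`, `R` being symmetric). [folklore] -/
theorem weighted_row_lowdin_kernel_le (G H : Matrix ι ι ℝ) (hGT : Gᵀ = G) (ω : ι → ι → ℝ) (hω1 : ∀ a b, 1 ≤ ω a b)
    (hωd : ∀ a, ω a a = 1) (hωm : ∀ a b c, ω a c ≤ ω a b * ω b c) {δ h : ℝ} (hδ : δ ≤ 1 / 2)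
    (hrowG : ∀ a, ∑ b, |(G - 1) a b| * ω a b ≤ δ) (hrowH : ∀ a, ∑ b, |H a b| * ω a b ≤ h) (a : ι) :
    ∑ c, |((CFC.sqrt G)⁻¹ * H * (CFC.sqrt G)⁻¹ - H) a c| * ω a c ≤ h * (δ / (1 - δ)) * (1 / (1 - δ) + 1) ∧
      ∑ c, |((CFC.sqrt G)⁻¹ * H * (CFC.sqrt G)⁻¹) a c| * ω a c ≤ h / (1 - δ) ^ 2 := by
  have hω0 : ∀ a b, 0 ≤ ω a b := fun a b => zero_le_one.trans (hω1 a b)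
  have hδ0 : 0 ≤ δ := (Finset.sum_nonneg fun b _ => mul_nonneg (abs_nonneg _) (hω0 a b)).trans (hrowG a)
  have hh0 : 0 ≤ h := (Finset.sum_nonneg fun b _ => mul_nonneg (abs_nonneg _) (hω0 a b)).trans (hrowH a)
  have hδ1 : 0 < 1 - δ := by linarith
  -- `G = 1 + ε` with `ε = G - 1` symmetric
  have hεT : (G - 1)ᵀ = G - 1 := by rw [transpose_sub, transpose_one, hGT]
  have hG : (1 : Matrix ι ι ℝ) + (G - 1) = G := add_sub_cancel 1 G
  set R : Matrix ι ι ℝ := (CFC.sqrt G)⁻¹ with hRdef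
  have hR1 : ∀ a, ∑ c, |(R - 1) a c| * ω a c ≤ δ / (1 - δ) := fun a => by
    have h := weighted_row_inv_sqrt_sub_one_le (G - 1) hεT ω hω1 hωd hωm hδ hrowG a
    rwa [hG] at h
  -- weighted row sums of `R = 1 + (R - 1)`: `≤ 1 + δ/(1-δ) = 1/(1-δ)`
  have hR : ∀ a, ∑ c, |R a c| * ω a c ≤ 1 / (1 - δ) := by
    intro a
    have hsplit : ∀ c, |R a c| * ω a c ≤ |(1 : Matrix ι ι ℝ) a c| * ω a c + |(R - 1) a c| * ω a c := fun c => by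
      rw [← add_mul]
      refine mul_le_mul_of_nonneg_right ?_ (hω0 a c)
      have : R a c = (1 : Matrix ι ι ℝ) a c + (R - 1) a c := by rw [Matrix.sub_apply]; ring
      rw [this]
      exact abs_add_le _ _
    have hone : ∑ c, |(1 : Matrix ι ι ℝ) a c| * ω a c = 1 := by
      rw [Finset.sum_eq_single a]
      · rw [Matrix.one_apply_eq, abs_one, one_mul, hωd]
      · intro c _ hca
        rw [Matrix.one_apply_ne' hca, abs_zero, zero_mul]
      · exact fun h' => absurd (Finset.mem_univ a) h'
    calc ∑ c, |R a c| * ω a c ≤ ∑ c, (|(1 : Matrix ι ι ℝ) a c| * ω a c + |(R - 1) a c| * ω a c) :=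
          Finset.sum_le_sum fun c _ => hsplit c
      _ = 1 + ∑ c, |(R - 1) a c| * ω a c := by rw [Finset.sum_add_distrib, hone]
      _ ≤ 1 + δ / (1 - δ) := by linarith [hR1 a]
      _ = 1 / (1 - δ) := by field_simp; ring
  -- `R H R - H = (R - 1) H R + H (R - 1)`
  have hsplit : R * H * R - H = (R - 1) * H * R + H * (R - 1) := by
    simp only [sub_mul, Matrix.one_mul, mul_sub, Matrix.mul_one]
    abel
  have hHR : ∀ b, ∑ c, |(H * R) b c| * ω b c ≤ h * (1 / (1 - δ)) := fun b =>
    (weighted_row_mul_le H R ω hω0 hωm hR b).trans (mul_le_mul_of_nonneg_right (hrowH b) (by positivity))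
  have hT1 : ∑ c, |((R - 1) * H * R) a c| * ω a c ≤ δ / (1 - δ) * (h * (1 / (1 - δ))) := by
    rw [Matrix.mul_assoc]
    exact (weighted_row_mul_le (R - 1) (H * R) ω hω0 hωm hHR a).trans
      (mul_le_mul_of_nonneg_right (hR1 a) (by positivity))
  have hT2 : ∑ c, |(H * (R - 1)) a c| * ω a c ≤ h * (δ / (1 - δ)) :=
    (weighted_row_mul_le H (R - 1) ω hω0 hωm hR1 a).trans (mul_le_mul_of_nonneg_right (hrowH a) (by positivity))
  refine ⟨?_, ?_⟩
  · rw [hsplit]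
    calc ∑ c, |((R - 1) * H * R + H * (R - 1)) a c| * ω a c
        ≤ ∑ c, (|((R - 1) * H * R) a c| * ω a c + |(H * (R - 1)) a c| * ω a c) := by
          refine Finset.sum_le_sum fun c _ => ?_
          rw [Matrix.add_apply, ← add_mul]
          exact mul_le_mul_of_nonneg_right (abs_add_le _ _) (hω0 a c)
      _ ≤ δ / (1 - δ) * (h * (1 / (1 - δ))) + h * (δ / (1 - δ)) := by
          rw [Finset.sum_add_distrib]
          exact add_le_add hT1 hT2
      _ = h * (δ / (1 - δ)) * (1 / (1 - δ) + 1) := by ring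
  · calc ∑ c, |(R * H * R) a c| * ω a c ≤ (∑ b, |R a b| * ω a b) * (h * (1 / (1 - δ))) := by
          rw [Matrix.mul_assoc]
          exact weighted_row_mul_le R (H * R) ω hω0 hωm hHR a
      _ ≤ 1 / (1 - δ) * (h * (1 / (1 - δ))) := mul_le_mul_of_nonneg_right (hR a) (by positivity)
      _ = h / (1 - δ) ^ 2 := by field_simp

end Summit.QuantumFields.YangMills.Theorems.GlueballBandRecursion.Lowdin

end
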